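import Mathlib.Analysis.ODE.DiscreteGronwall
import Mathlib.MeasureTheory.Integral.Lebesgue.Add
import Literature.MathematicalPhysics.KineticTheory.NewtonianFlow
import HarnessLib

/-!
# Liouville's theorem for Newtonian flows with bounded Lipschitz force

For `F : ℝ^N → ℝ^N` globally `K`-Lipschitz with `‖F‖ ≤ M`, every flow `Φ` of `q̇ = p`, `ṗ = F(q)`
(`NewtonianFlow.IsFlow F Φ`) preserves Lebesgue measure on the phase space:
`NewtonianFlow.IsFlow.measurePreserving : MeasurePreserving (Φ t) volume volume` — Liouville's
theorem "the phase flow preserves volume" [cite: Arnold1978, §16 Thm 1] for this class of systems.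
This is the GENERAL (force-field–parametric) version; the rotor-chain instance
`RotorChain.IsFlow.measurePreserving` (with `RotorChain.IsFlow.tendsto_iterate_eulerStep`,
`RotorChain.norm_eulerStep_sub_le`, …) of
`Literature/Barriers/AtomisticToContinuum/AnticontinuumLocalizationProofs.lean`, landed
2026-08-15 for the De Roeck–Huveneers Theorem 4 reduction by the same splitting method, is the case
`F := RotorChain.force N ε γ`; see the header of `NewtonianFlow.lean` for the correspondence and
the intended later derivation of the special case from this file.

The proof avoids Jacobians (Mathlib has no differentiability of flows in the initial datum):
1. `IsFlow.norm_eulerStep_sub_le` — local error `‖S_h w - Φ_h w‖ ≤ (M + KM|h| + K‖p‖)h²` of the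
   symplectic Euler step `S_h` (`NewtonianFlow.eulerStep`, a composition of two volume-preserving
   shears) along the flow, from the a priori bounds of `NewtonianFlow.lean`;
2. `IsFlow.norm_iterate_eulerStep_sub_le` — global error `‖S_{t/k}^k z - Φ_t z‖ ≤ C(z,t)/k`
   (error recursion `u_{j+1} ≤ L u_j + Bh²`, `le_of_error_recursion`), hence
   `IsFlow.tendsto_iterate_eulerStep` (pointwise convergence of the scheme);
3. `IsFlow.volume_preimage_le_of_isOpen` — Fatou's lemma on the indicators of an open set `U`
   along the volume-preserving iterates: `vol(Φ_t⁻¹ U) ≤ vol U`; with `Φ_{-t} = Φ_t⁻¹` this is an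
   equality (`IsFlow.volume_preimage_of_isOpen`), and Borel measures on `ℝ^{2N}` agreeing on open
   sets coincide (`Measure.ext_of_generateFrom_of_iUnion`).
-/

noncomputable section

open MeasureTheory Filter Topology Set

namespace Literature.MathematicalPhysics.KineticTheory

open HeatConduction (PhaseSpace)

namespace NewtonianFlow


variable {N : ℕ} {F : (Fin N → ℝ) → (Fin N → ℝ)} {Φ : ℝ → PhaseSpace N → PhaseSpace N}

/-- **Local error of the symplectic Euler step** along the flow:
`‖S_h(w) - Φ_h(w)‖ ≤ (M + KM|h| + K‖p‖) h²` for `F` `K`-Lipschitz with `‖F‖ ≤ M`. [folklore] -/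
theorem IsFlow.norm_eulerStep_sub_le (hΦ : IsFlow F Φ) {K : NNReal} (hF : LipschitzWith K F)
    {M : ℝ} (hM : ∀ q, ‖F q‖ ≤ M) (h : ℝ) (w : PhaseSpace N) :
    ‖eulerStep F h w - Φ h w‖ ≤ (M + K * M * |h| + K * ‖w.2‖) * h ^ 2 := by
  have hM0 : 0 ≤ M := (norm_nonneg _).trans (hM 0)
  have hK0 : (0 : ℝ) ≤ K := K.2
  -- position component
  have h1 : ‖(w.1 + h • w.2) - (Φ h w).1‖ ≤ M * h ^ 2 := by
    rw [← norm_neg]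
    have e : -((w.1 + h • w.2) - (Φ h w).1) = (Φ h w).1 - w.1 - h • w.2 := by abel
    rw [e]
    exact hΦ.norm_fst_sub_le hM h w
  -- momentum component
  set a := w.1 + h • w.2 with ha
  have hd : ∀ s, HasDerivAt (fun s => (Φ s w).2 - s • F a) (F (Φ s w).1 - F a) s := fun s => by
    have := (hΦ.hasDerivAt_snd w s).sub ((hasDerivAt_id s).smul_const (F a))
    simp only [id, one_smul] at this
    exact this
  have hbound : ∀ s ∈ uIcc 0 h, ‖F (Φ s w).1 - F a‖ ≤ K * (M * h ^ 2 + |h| * ‖w.2‖) := by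
    intro s hs
    have hs1 : |s| ≤ |h| := by simpa using Set.abs_sub_left_of_mem_uIcc hs
    have hs2 : |h - s| ≤ |h| := by simpa using Set.abs_sub_right_of_mem_uIcc hs
    refine (hF.norm_sub_le _ _).trans (mul_le_mul_of_nonneg_left ?_ hK0)
    have e : (Φ s w).1 - a = ((Φ s w).1 - w.1 - s • w.2) + (s - h) • w.2 := by
      rw [ha, sub_smul]; abel
    rw [e]
    refine (norm_add_le _ _).trans (add_le_add ?_ ?_)
    · refine (hΦ.norm_fst_sub_le hM s w).trans (mul_le_mul_of_nonneg_left ?_ hM0)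
      rw [← sq_abs, ← sq_abs h]
      exact pow_le_pow_left₀ (abs_nonneg s) hs1 2
    · rw [norm_smul, Real.norm_eq_abs, abs_sub_comm]
      exact mul_le_mul_of_nonneg_right hs2 (norm_nonneg _)
  have h2 := Convex.norm_image_sub_le_of_norm_hasDerivWithin_le (f := fun s => (Φ s w).2 - s • F a)
    (f' := fun s => F (Φ s w).1 - F a) (s := uIcc 0 h) (C := K * (M * h ^ 2 + |h| * ‖w.2‖))
    (fun s _ => (hd s).hasDerivWithinAt) hbound (convex_uIcc 0 h) left_mem_uIcc right_mem_uIcc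
  simp only [zero_smul, sub_zero, hΦ.2.1, Real.norm_eq_abs] at h2
  -- h2 : ‖(Φ h w).2 - h • F a - w.2‖ ≤ K * (M * h ^ 2 + |h| * ‖w.2‖) * |h|
  have h2' : ‖(w.2 + h • F a) - (Φ h w).2‖ ≤ K * (M * h ^ 2 + |h| * ‖w.2‖) * |h| := by
    rw [← norm_neg]
    have e : -((w.2 + h • F a) - (Φ h w).2) = (Φ h w).2 - h • F a - w.2 := by abel
    rw [e]; exact h2
  -- assemble
  rw [eulerStep_apply, Prod.norm_def, Prod.fst_sub, Prod.snd_sub]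
  refine max_le (h1.trans ?_) (h2'.trans ?_)
  · have : 0 ≤ (K * M * |h| + K * ‖w.2‖) * h ^ 2 := by positivity
    nlinarith
  · have e : K * (M * h ^ 2 + |h| * ‖w.2‖) * |h| = (K * M * |h| + K * ‖w.2‖) * h ^ 2 := by
      have : |h| * |h| = h ^ 2 := by rw [← sq, sq_abs]
      calc K * (M * h ^ 2 + |h| * ‖w.2‖) * |h|
          = K * M * |h| * h ^ 2 + K * ‖w.2‖ * (|h| * |h|) := by ring
        _ = (K * M * |h| + K * ‖w.2‖) * h ^ 2 := by rw [this]; ring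
    rw [e]
    have : 0 ≤ M * h ^ 2 := by positivity
    nlinarith

/-- Error recursion `u_{j+1} ≤ L u_j + b`, `u_0 = 0`, `L ≥ 1`, `b ≥ 0` gives `u_j ≤ j b L^j`.
[folklore] -/
theorem le_of_error_recursion {u : ℕ → ℝ} {L b : ℝ} (hL : 1 ≤ L) (hb : 0 ≤ b) (h0 : u 0 = 0)
    {k : ℕ} (hu : ∀ j < k, u (j + 1) ≤ L * u j + b) : ∀ j ≤ k, u j ≤ j * b * L ^ j := by
  intro j hj
  induction j with
  | zero => simp [h0]
  | succ j ih =>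
    have ih' := ih (Nat.le_of_succ_le hj)
    have hLj : 1 ≤ L ^ (j + 1) := one_le_pow₀ hL
    calc u (j + 1) ≤ L * u j + b := hu j (Nat.lt_of_succ_le hj)
      _ ≤ L * (j * b * L ^ j) + b * L ^ (j + 1) := by
          have h1 : L * u j ≤ L * (j * b * L ^ j) :=
            mul_le_mul_of_nonneg_left ih' (zero_le_one.trans hL)
          have h2 : b ≤ b * L ^ (j + 1) := le_mul_of_one_le_right hb hLj
          linarith
      _ = ((j : ℝ) + 1) * b * L ^ (j + 1) := by rw [pow_succ]; ring
      _ = ((j + 1 : ℕ) : ℝ) * b * L ^ (j + 1) := by push_cast; ring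

/-- **Global error of the symplectic Euler scheme**: with `k` steps of size `h = t/k`,
`‖S_h^k(z) - Φ_t(z)‖ ≤ C(z, t)/k`. [folklore] -/
theorem IsFlow.norm_iterate_eulerStep_sub_le (hΦ : IsFlow F Φ) {K : NNReal} (hF : LipschitzWith K F)
    {M : ℝ} (hM : ∀ q, ‖F q‖ ≤ M) (t : ℝ) (z : PhaseSpace N) {k : ℕ} (hk : 0 < k) :
    ‖(eulerStep F (t / k))^[k] z - Φ t z‖ ≤
      ((M + K * M * |t| + K * (‖z.2‖ + M * |t|)) * t ^ 2 *
        Real.exp (|t| * K + |t| + t ^ 2 * K)) / k := by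
  have hM0 : 0 ≤ M := (norm_nonneg _).trans (hM 0)
  have hK0 : (0 : ℝ) ≤ K := K.2
  have hk0 : (0 : ℝ) < k := by exact_mod_cast hk
  set h : ℝ := t / k with hh
  have hkh : (k : ℝ) * h = t := by rw [hh]; field_simp
  have habs : |h| ≤ |t| := by
    rw [hh, abs_div, Nat.abs_cast]
    exact div_le_self (abs_nonneg t) (by exact_mod_cast hk)
  set L : ℝ := (1 + |h| * K) * (1 + |h|) with hL
  have hL1 : 1 ≤ L := by
    have h1 : 1 ≤ 1 + |h| * K := le_add_of_nonneg_right (by positivity)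
    have h2 : 1 ≤ 1 + |h| := le_add_of_nonneg_right (abs_nonneg h)
    calc (1 : ℝ) = 1 * 1 := (mul_one 1).symm
      _ ≤ L := mul_le_mul h1 h2 zero_le_one (zero_le_one.trans h1)
  set B : ℝ := M + K * M * |t| + K * (‖z.2‖ + M * |t|) with hB
  have hB0 : 0 ≤ B := by positivity
  -- the error sequence
  set u : ℕ → ℝ := fun j => ‖(eulerStep F h)^[j] z - Φ (j * h) z‖ with hu
  have hu0 : u 0 = 0 := by simp [hu, hΦ.2.1]
  have hrec : ∀ j < k, u (j + 1) ≤ L * u j + B * h ^ 2 := by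
    intro j hj
    have hgroup : Φ ((j + 1 : ℕ) * h) z = Φ h (Φ (j * h) z) := by
      rw [← hΦ.add_apply hF]; congr 1; push_cast; ring
    have hloc := hΦ.norm_eulerStep_sub_le hF hM h (Φ (j * h) z)
    have hp : ‖(Φ (j * h) z).2‖ ≤ ‖z.2‖ + M * |t| := by
      have h1 := hΦ.norm_snd_sub_le hM (j * h) z
      have h2 : M * |(j : ℝ) * h| ≤ M * |t| := by
        refine mul_le_mul_of_nonneg_left ?_ hM0
        rw [abs_mul, Nat.abs_cast, ← hkh, abs_mul, Nat.abs_cast]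
        exact mul_le_mul_of_nonneg_right (by exact_mod_cast hj.le) (abs_nonneg h)
      calc ‖(Φ (j * h) z).2‖ = ‖z.2 + ((Φ (j * h) z).2 - z.2)‖ := by congr 1; abel
        _ ≤ ‖z.2‖ + ‖(Φ (j * h) z).2 - z.2‖ := norm_add_le _ _
        _ ≤ ‖z.2‖ + M * |t| := by linarith
    have hcoef : M + K * M * |h| + K * ‖(Φ (j * h) z).2‖ ≤ B := by
      rw [hB]; gcongr
    calc u (j + 1) = ‖eulerStep F h ((eulerStep F h)^[j] z) - Φ h (Φ (j * h) z)‖ := by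
          simp only [hu, Function.iterate_succ_apply', hgroup]
      _ ≤ ‖eulerStep F h ((eulerStep F h)^[j] z) - eulerStep F h (Φ (j * h) z)‖ +
            ‖eulerStep F h (Φ (j * h) z) - Φ h (Φ (j * h) z)‖ := norm_sub_le_norm_sub_add_norm_sub _ _ _
      _ ≤ L * u j + (M + K * M * |h| + K * ‖(Φ (j * h) z).2‖) * h ^ 2 :=
          add_le_add (dist_eulerStep_le hF h _ _) hloc
      _ ≤ L * u j + B * h ^ 2 := by gcongr
  have hfinal := le_of_error_recursion hL1 (by positivity) hu0 hrec k le_rfl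
  -- u k = the quantity; bound k * (B h²) * L^k
  have hLk : L ^ k ≤ Real.exp (|t| * K + |t| + t ^ 2 * K) := by
    have h1 : L ≤ Real.exp (|h| * K + |h| + h ^ 2 * K) := by
      have e : L = 1 + (|h| * K + |h| + h ^ 2 * K) := by
        rw [hL]; have : |h| * |h| = h ^ 2 := by rw [← sq, sq_abs]
        calc (1 + |h| * K) * (1 + |h|) = 1 + (|h| * K + |h| + |h| * |h| * K) := by ring
          _ = 1 + (|h| * K + |h| + h ^ 2 * K) := by rw [this]
      rw [e, add_comm]; exact Real.add_one_le_exp _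
    calc L ^ k ≤ (Real.exp (|h| * K + |h| + h ^ 2 * K)) ^ k :=
          pow_le_pow_left₀ (zero_le_one.trans hL1) h1 k
      _ = Real.exp (k * (|h| * K + |h| + h ^ 2 * K)) := by rw [← Real.exp_nat_mul]
      _ ≤ Real.exp (|t| * K + |t| + t ^ 2 * K) := by
          refine Real.exp_le_exp.2 ?_
          have e1 : (k : ℝ) * |h| = |t| := by rw [← hkh, abs_mul, Nat.abs_cast]
          have e2 : (k : ℝ) * h ^ 2 ≤ t ^ 2 := by
            have : (k : ℝ) * h ^ 2 * 1 ≤ (k : ℝ) * h ^ 2 * k :=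
              mul_le_mul_of_nonneg_left (by exact_mod_cast hk) (by positivity)
            calc (k : ℝ) * h ^ 2 = (k : ℝ) * h ^ 2 * 1 := (mul_one _).symm
              _ ≤ (k : ℝ) * h ^ 2 * k := this
              _ = (k * h) ^ 2 := by ring
              _ = t ^ 2 := by rw [hkh]
          calc (k : ℝ) * (|h| * K + |h| + h ^ 2 * K) = (k * |h|) * K + k * |h| + (k * h ^ 2) * K := by ring
            _ ≤ |t| * K + |t| + t ^ 2 * K := by rw [e1]; gcongr
  have e3 : (k : ℝ) * (B * h ^ 2) = B * t ^ 2 / k := by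
    rw [hh]; field_simp
  calc ‖(eulerStep F (t / k))^[k] z - Φ t z‖ = u k := by simp only [hu]; rw [hkh]
    _ ≤ k * (B * h ^ 2) * L ^ k := hfinal
    _ ≤ k * (B * h ^ 2) * Real.exp (|t| * K + |t| + t ^ 2 * K) := by gcongr
    _ = (B * t ^ 2 * Real.exp (|t| * K + |t| + t ^ 2 * K)) / k := by rw [e3]; ring

/-- **Convergence of the symplectic Euler scheme** to the flow, pointwise:
`S_{t/k}^k(z) → Φ_t(z)` as `k → ∞`. [folklore] -/
theorem IsFlow.tendsto_iterate_eulerStep (hΦ : IsFlow F Φ) {K : NNReal} (hF : LipschitzWith K F)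
    {M : ℝ} (hM : ∀ q, ‖F q‖ ≤ M) (t : ℝ) (z : PhaseSpace N) :
    Tendsto (fun k : ℕ => (eulerStep F (t / (k + 1 : ℕ)))^[k + 1] z) atTop (𝓝 (Φ t z)) := by
  set C : ℝ := (M + K * M * |t| + K * (‖z.2‖ + M * |t|)) * t ^ 2 *
    Real.exp (|t| * K + |t| + t ^ 2 * K) with hC
  rw [tendsto_iff_norm_sub_tendsto_zero]
  have hb : ∀ k : ℕ, ‖(eulerStep F (t / (k + 1 : ℕ)))^[k + 1] z - Φ t z‖ ≤ C / ((k + 1 : ℕ) : ℝ) :=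
    fun k => hΦ.norm_iterate_eulerStep_sub_le hF hM t z (Nat.succ_pos k)
  have hlim : Tendsto (fun k : ℕ => C / ((k + 1 : ℕ) : ℝ)) atTop (𝓝 0) := by
    have h := (tendsto_const_div_atTop_nhds_zero_nat C).comp (tendsto_add_atTop_nat 1)
    exact h
  exact squeeze_zero (fun k => norm_nonneg _) hb hlim

/-- **Fatou step of Liouville's theorem**: the flow map does not increase the volume of open
sets, `vol(Φ_t⁻¹ U) ≤ vol(U)` (the Euler iterates preserve volume and converge pointwise).
[folklore] -/
theorem IsFlow.volume_preimage_le_of_isOpen (hΦ : IsFlow F Φ) {K : NNReal} (hF : LipschitzWith K F)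
    {M : ℝ} (hM : ∀ q, ‖F q‖ ≤ M) (hFc : Continuous F) (t : ℝ) {U : Set (PhaseSpace N)}
    (hU : IsOpen U) : volume (Φ t ⁻¹' U) ≤ volume U := by
  set Ψ : ℕ → PhaseSpace N → PhaseSpace N := fun k => (eulerStep F (t / (k + 1 : ℕ)))^[k + 1]
    with hΨ
  have hΨc : ∀ k, Continuous (Ψ k) := fun k => (continuous_eulerStep hFc _).iterate _
  have hΨm : ∀ k, MeasurePreserving (Ψ k) volume volume := fun k =>
    (measurePreserving_eulerStep hFc.measurable _).iterate _
  have hconv : ∀ z, Tendsto (fun k => Ψ k z) atTop (𝓝 (Φ t z)) := fun z =>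
    hΦ.tendsto_iterate_eulerStep hF hM t z
  have hmU : MeasurableSet U := hU.measurableSet
  -- pointwise Fatou inequality for the indicators
  have hle : ∀ z, (Φ t ⁻¹' U).indicator (1 : PhaseSpace N → ENNReal) z ≤
      liminf (fun k => ((Ψ k) ⁻¹' U).indicator (1 : PhaseSpace N → ENNReal) z) atTop := by
    intro z
    by_cases hz : Φ t z ∈ U
    · have hev : ∀ᶠ k in atTop, Ψ k z ∈ U := (hconv z) (hU.mem_nhds hz)
      refine le_liminf_of_le (f := (atTop : Filter ℕ))
        (u := fun k => ((Ψ k) ⁻¹' U).indicator (1 : PhaseSpace N → ENNReal) z) (by isBoundedDefault) ?_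
      filter_upwards [hev] with k hk
      have hk' : z ∈ (Ψ k) ⁻¹' U := hk
      have hz' : z ∈ Φ t ⁻¹' U := hz
      rw [Set.indicator_of_mem hk', Set.indicator_of_mem hz']
    · have hz' : z ∉ Φ t ⁻¹' U := hz
      rw [Set.indicator_of_notMem hz']
      exact bot_le
  calc volume (Φ t ⁻¹' U)
      = ∫⁻ z, (Φ t ⁻¹' U).indicator 1 z := (lintegral_indicator_one
          (hmU.preimage (hΦ.continuous_apply t).measurable)).symm
    _ ≤ ∫⁻ z, liminf (fun k => ((Ψ k) ⁻¹' U).indicator (1 : PhaseSpace N → ENNReal) z) atTop :=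
          lintegral_mono hle
    _ ≤ liminf (fun k => ∫⁻ z, ((Ψ k) ⁻¹' U).indicator (1 : PhaseSpace N → ENNReal) z) atTop :=
          lintegral_liminf_le fun k => (measurable_one.indicator (hmU.preimage (hΨc k).measurable))
    _ = liminf (fun _ : ℕ => volume U) atTop := by
          refine congrArg (fun f : ℕ → ENNReal => liminf f atTop) (funext fun k => ?_)
          rw [lintegral_indicator_one (hmU.preimage (hΨc k).measurable), (hΨm k).measure_preimage
            hmU.nullMeasurableSet]
    _ = volume U := liminf_const _

/-- The flow maps preserve the volume of open sets. [folklore] -/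
theorem IsFlow.volume_preimage_of_isOpen (hΦ : IsFlow F Φ) {K : NNReal} (hF : LipschitzWith K F)
    {M : ℝ} (hM : ∀ q, ‖F q‖ ≤ M) (hFc : Continuous F) (t : ℝ) {U : Set (PhaseSpace N)}
    (hU : IsOpen U) : volume (Φ t ⁻¹' U) = volume U := by
  refine le_antisymm (hΦ.volume_preimage_le_of_isOpen hF hM hFc t hU) ?_
  have hU' : IsOpen (Φ t ⁻¹' U) := hU.preimage (hΦ.continuous_apply t)
  have h := hΦ.volume_preimage_le_of_isOpen hF hM hFc (-t) hU'
  have e : Φ (-t) ⁻¹' (Φ t ⁻¹' U) = U := by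
    ext z; simp [hΦ.apply_neg_apply hF]
  rwa [e] at h

/-- **Liouville's theorem** for the Newtonian flow `q̇ = p`, `ṗ = F(q)` with bounded Lipschitz
force: every flow map `Φ_t` preserves Lebesgue measure `dq dp` on phase space ("The phase flow
preserves volume"). Proof without Jacobians: `Φ_t` is the pointwise limit of compositions of
shears, which preserve volume; Fatou's lemma gives `vol(Φ_t⁻¹U) ≤ vol U` for open `U`, equality
follows from `Φ_{-t} = Φ_t⁻¹`, and Borel measures on `ℝ^{2N}` agreeing on open sets coincide.
[cite: Arnold1978, §16 Thm 1] -/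
theorem IsFlow.measurePreserving (hΦ : IsFlow F Φ) {K : NNReal} (hF : LipschitzWith K F)
    {M : ℝ} (hM : ∀ q, ‖F q‖ ≤ M) (hFc : Continuous F) (t : ℝ) :
    MeasurePreserving (Φ t) volume volume := by
  have hmeas : Measurable (Φ t) := (hΦ.continuous_apply t).measurable
  refine ⟨hmeas, ?_⟩
  symm
  refine Measure.ext_of_generateFrom_of_iUnion {U : Set (PhaseSpace N) | IsOpen U}
    (fun n : ℕ => Metric.ball 0 (n + 1)) (BorelSpace.measurable_eq) isPiSystem_isOpen ?_
    (fun n => show IsOpen (Metric.ball (0 : PhaseSpace N) (n + 1)) from Metric.isOpen_ball)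
    (fun n => (measure_ball_lt_top).ne) ?_
  · apply iUnion_eq_univ_iff.2
    intro z
    refine ⟨⌈‖z‖⌉₊, ?_⟩
    rw [Metric.mem_ball, dist_zero_right]
    exact (Nat.le_ceil ‖z‖).trans_lt (lt_add_one _)
  · intro U hU
    have hU' : IsOpen U := hU
    rw [Measure.map_apply hmeas hU'.measurableSet]
    exact (hΦ.volume_preimage_of_isOpen hF hM hFc t hU').symm

end NewtonianFlow

end Literature.MathematicalPhysics.KineticTheory

end
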